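import Literature.NumberTheory.LFunctions.ImaginaryQuadraticGrossencharakterDualSide
import HarnessLib

/-!
# Hecke's functional equation for the `L`-series of a primitive Größencharakter of type `(m, 0)` of an imaginary quadratic
# field (Hecke 1920; de Shalit 1987 II.1.1 (1)–(3); Neukirch VII (8.5)–(8.6))

Topic `Literature/NumberTheory/LFunctions`; namespace `Literature.NumberTheory.LFunctions`.  Final ideal-theoretic file of the
chain `HeckeGaussianFourierComplex` → `HeckeThetaInversionComplexWeight` → `HeckeThetaComplexWeightMellin` →
`GrossencharakterFinitePartGaussSum` → `ImaginaryQuadraticGrossencharakterLSeries` → `ImaginaryQuadraticGrossencharakterDualSide`;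
port of §ClassData + §Main of `RayClassFunctionalEquation.lean` (sign types) to the harmonic weight `σ^m`.  Everything PROVED.

> **de Shalit II.1.1 (1)–(3)** (Hecke 1920; Neukirch VII (8.5)–(8.6)). For a Größencharakter `χ` of the imaginary quadratic field
> `K` of infinity type `(m, 0)` and conductor `𝔣`: `R(χ, s) = (d_K N𝔣)^{s/2} (2π)^{-s} Γ(s) L(χ, s)` is entire and
> `R(χ, s) = W · R(χ̄, m + 1 - s)`, `|W| = 1`.

* `grossLSeries_functional_equation` — for `ψ` with `HasEmbPowType 𝔪 σ_w m ψ` (`m ≥ 1`), PRIMITIVE (`IsPrimitiveGross`), `𝔪 ≠ 0`: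
  `∃ W, Λ` with `‖W‖ = 1`, `Λ` ENTIRE, `Λ(s) = (|d_K| 𝔑𝔪)^{s/2} (2π)^{-s} Γ(s) L(χ, s)` for `re s > m/2 + 1`
  (`L = rayClassLSeries 𝔪 ψ`) and `Λ(m+1-s) = W (|d_K| 𝔑𝔪)^{s/2} (2π)^{-s} Γ(s) L(χ̄, s)` there (`χ̄ = star ψ`);
  `grossLSeries_functional_equation'` — the two-function form (`Λ'` entire continuing `R(χ̄,·)`, `Λ(s) = W Λ'(m+1-s)` for all `s`).
  Proof: Neukirch's — class decomposition, f-side (`sum_grossFinitePart_mul_Λ_eq`), Mathlib's Mellin principle per coset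
  (`heckeThetaPairC_Λ_sub`), g-side (`sum_grossFinitePart_mul_symm_Λ_eq`), root number from `grossGaussSum_invariant`,
  `norm_grossGaussSum`, `sq_norm_idealPow_eq_absNorm_pow`; `W = (-i)^m (d𝔑𝔪)^{-(m+1)/2} √d · χ̃(𝔶)τ(y)/σ(y)^m`.

## References

* J. Neukirch, *Algebraic Number Theory*, Grundlehren 322, Springer 1999, Ch. VII §8 Thm. (8.5), Cor. (8.6) and Remark 1. [NeukirchANT1999]
* E. de Shalit, *Iwasawa theory of elliptic curves with complex multiplication*, Academic Press 1987, II §1.1 (1)–(3). [deShalit1987]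
* E. Hecke, Math. Z. 6 (1920), 11–51. [HeckeMathZ1920]
-/

noncomputable section

open scoped FourierTransform nonZeroDivisors ComplexConjugate Real
open NumberField NumberField.InfinitePlace IsDedekindDomain Complex
open Literature.NumberTheory.GaloisRepresentations

namespace Literature.NumberTheory.LFunctions

variable {K : Type*} [Field K] [NumberField K]

open scoped Classical

/-! ## Class data -/

section ClassData

variable {𝔪 : Ideal (𝓞 K)} {ψ : HeightOneSpectrum (𝓞 K) → ℂ} {σ : K →+* ℂ} {m : ℕ}

/-- `χ̃(b𝔟⁻¹) χ̃(𝔟) = σ(b)^m` for `b ∈ 𝔟`, `b ≡ 1 mod 𝔪` (`χ̃((b)) = σ(b)^m` on the ray), and `b𝔟⁻¹` is prime to `𝔪`.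
[cite: NeukirchANT1999, Ch. VII §6 Prop. (6.2)] -/
theorem idealPow_eltIdeal_mul_of_sub_one_mem (hψ : HasEmbPowType 𝔪 σ m ψ) {𝔟 : Ideal (𝓞 K)} (h𝔟 : 𝔟 ≠ ⊥)
    {b : 𝓞 K} (hb : b ∈ 𝔟) (hb0 : b ≠ 0) (hb1 : b - 1 ∈ 𝔪) :
    idealPow K ψ (eltIdeal (𝔟 : FractionalIdeal (𝓞 K)⁰ K) b (FractionalIdeal.mem_coeIdeal_of_mem _ hb)) * idealPow K ψ 𝔟 =
      σ b ^ m ∧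
    IsCoprime (eltIdeal (𝔟 : FractionalIdeal (𝓞 K)⁰ K) b (FractionalIdeal.mem_coeIdeal_of_mem _ hb)) 𝔪 := by
  have hbK : (b : K) ∈ (𝔟 : FractionalIdeal (𝓞 K)⁰ K) := FractionalIdeal.mem_coeIdeal_of_mem _ hb
  have hspan := span_singleton_eq_eltIdeal_mul h𝔟 hbK
  have hcopb : IsCoprime (Ideal.span {b}) 𝔪 := isCoprime_span_singleton_of_sub_one_mem hb1
  have hcope : IsCoprime (eltIdeal (𝔟 : FractionalIdeal (𝓞 K)⁰ K) b hbK) 𝔪 := by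
    rw [hspan] at hcopb; exact hcopb.of_mul_left_left
  refine ⟨?_, hcope⟩
  have h0 : eltIdeal (𝔟 : FractionalIdeal (𝓞 K)⁰ K) b hbK ≠ ⊥ :=
    eltIdeal_ne_bot (FractionalIdeal.coeIdeal_ne_zero.mpr h𝔟) hbK (by exact_mod_cast hb0)
  have h := hψ.idealPow_span_eq_pow hb0 hb1
  rwa [hspan, idealPow_mul ψ h0 h𝔟] at h

/-- **The data of a class.**  For `(β) = 𝔟𝔟'𝔪𝔡`, `b₀ ∈ 𝔟`, `x₁ ∈ 𝔟'` both `≡ 1 mod 𝔪`, with `y = b₀x₁/β` and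
`𝔶 = (b₀𝔟⁻¹)(x₁𝔟'⁻¹)`: `(𝔶) = y𝔪𝔡`, `𝔶` is prime to `𝔪`, `y ≠ 0`, and `χ̃(𝔶) χ̃(𝔟) χ̃(𝔟') = σ(b₀)^m σ(x₁)^m`.
[cite: NeukirchANT1999, Ch. VII §8 proof of (8.5) (the choice of representatives)] -/
theorem grossClassData_aux (hψ : HasEmbPowType 𝔪 σ m ψ) (h𝔪 : 𝔪 ≠ ⊥)
    {𝔟 : Ideal (𝓞 K)} (h𝔟 : 𝔟 ≠ ⊥) {b₀ : 𝓞 K} (hb₀ : b₀ ∈ 𝔟) (hb₀0 : b₀ ≠ 0) (hb₀1 : b₀ - 1 ∈ 𝔪)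
    {𝔟' : Ideal (𝓞 K)} (h𝔟' : 𝔟' ≠ ⊥) {x₁ : 𝓞 K} (hx₁ : x₁ ∈ 𝔟') (hx₁0 : x₁ ≠ 0) (hx₁1 : x₁ - 1 ∈ 𝔪)
    {β : 𝓞 K} (hβ0 : β ≠ 0) (hβ : 𝔟 * 𝔟' * 𝔪 * differentIdeal ℤ (𝓞 K) = Ideal.span {β}) :
    let 𝔶 : Ideal (𝓞 K) := eltIdeal (𝔟 : FractionalIdeal (𝓞 K)⁰ K) b₀ (FractionalIdeal.mem_coeIdeal_of_mem _ hb₀) *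
      eltIdeal (𝔟' : FractionalIdeal (𝓞 K)⁰ K) x₁ (FractionalIdeal.mem_coeIdeal_of_mem _ hx₁)
    ((𝔶 : FractionalIdeal (𝓞 K)⁰ K) = FractionalIdeal.spanSingleton (𝓞 K)⁰ ((b₀ : K) * x₁ / β) * 𝔪 * differentIdeal ℤ (𝓞 K)) ∧
      IsCoprime 𝔶 𝔪 ∧ ((b₀ : K) * x₁ / β) ≠ 0 ∧
      idealPow K ψ 𝔶 * idealPow K ψ 𝔟 * idealPow K ψ 𝔟' = σ b₀ ^ m * σ x₁ ^ m := by
  intro 𝔶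
  have hβK : ((β : 𝓞 K) : K) ≠ 0 := by exact_mod_cast hβ0
  have hb0K : ((b₀ : 𝓞 K) : K) ≠ 0 := by exact_mod_cast hb₀0
  have hx0K : ((x₁ : 𝓞 K) : K) ≠ 0 := by exact_mod_cast hx₁0
  have hbF : (𝔟 : FractionalIdeal (𝓞 K)⁰ K) ≠ 0 := FractionalIdeal.coeIdeal_ne_zero.mpr h𝔟
  have hbF' : (𝔟' : FractionalIdeal (𝓞 K)⁰ K) ≠ 0 := FractionalIdeal.coeIdeal_ne_zero.mpr h𝔟'
  have hm0 := coeIdeal_ne_zero' (K := K) h𝔪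
  have hd0 := coeIdeal_differentIdeal_ne_zero (K := K)
  obtain ⟨hIb, hcb⟩ := idealPow_eltIdeal_mul_of_sub_one_mem hψ h𝔟 hb₀ hb₀0 hb₀1
  obtain ⟨hIx, hcx⟩ := idealPow_eltIdeal_mul_of_sub_one_mem hψ h𝔟' hx₁ hx₁0 hx₁1
  have hβ' : (𝔟 : FractionalIdeal (𝓞 K)⁰ K) * 𝔟' * 𝔪 * differentIdeal ℤ (𝓞 K) =
      FractionalIdeal.spanSingleton (𝓞 K)⁰ (β : K) := by
    have := congrArg (fun I : Ideal (𝓞 K) ↦ (I : FractionalIdeal (𝓞 K)⁰ K)) hβ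
    simpa only [FractionalIdeal.coeIdeal_mul, FractionalIdeal.coeIdeal_span_singleton] using this
  refine ⟨?_, hcb.mul_left hcx, ?_, ?_⟩
  · rw [FractionalIdeal.coeIdeal_mul, coe_eltIdeal, coe_eltIdeal]
    have : FractionalIdeal.spanSingleton (𝓞 K)⁰ ((b₀ : K) * x₁ / β) =
        FractionalIdeal.spanSingleton (𝓞 K)⁰ (b₀ : K) * FractionalIdeal.spanSingleton (𝓞 K)⁰ (x₁ : K) *
          (FractionalIdeal.spanSingleton (𝓞 K)⁰ (β : K))⁻¹ := by
      rw [div_eq_mul_inv, ← FractionalIdeal.spanSingleton_mul_spanSingleton, ← FractionalIdeal.spanSingleton_mul_spanSingleton,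
        FractionalIdeal.spanSingleton_inv]
    rw [this, ← hβ']
    field_simp
  · exact div_ne_zero (mul_ne_zero hb0K hx0K) hβK
  · have h𝔶0b : eltIdeal (𝔟 : FractionalIdeal (𝓞 K)⁰ K) b₀ (FractionalIdeal.mem_coeIdeal_of_mem _ hb₀) ≠ ⊥ :=
      eltIdeal_ne_bot hbF _ hb0K
    have h𝔶0x : eltIdeal (𝔟' : FractionalIdeal (𝓞 K)⁰ K) x₁ (FractionalIdeal.mem_coeIdeal_of_mem _ hx₁) ≠ ⊥ :=
      eltIdeal_ne_bot hbF' _ hx0K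
    rw [show idealPow K ψ 𝔶 = _ from idealPow_mul ψ h𝔶0b h𝔶0x]
    linear_combination idealPow K ψ (eltIdeal (𝔟' : FractionalIdeal (𝓞 K)⁰ K) x₁ (FractionalIdeal.mem_coeIdeal_of_mem _ hx₁)) *
      idealPow K ψ 𝔟' * hIb + σ b₀ ^ m * hIx

end ClassData

/-! ## The scalar identity behind the root number -/

/-- The scalar identity behind the root number (all bases positive reals):
`(dM)^{(m+1-s)/2} b^{m+1-s} (M b √d)⁻¹ (b b' M d)^{s} b'^{-s} = (dM)^{s/2} · (dM)^{(m-1)/2} √d b^m`.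
[cite: NeukirchANT1999, Ch. VII §8 proof of (8.5)] -/
theorem grossRootNumber_scalar_identity {d M b b' : ℝ} (hd : 0 < d) (hM : 0 < M) (hb : 0 < b) (hb' : 0 < b') (m : ℕ) (s : ℂ) :
    ((d * M : ℝ) : ℂ) ^ (((m : ℂ) + 1 - s) / 2) * ((b : ℂ) ^ ((m : ℂ) + 1 - s)) * (((M * b * Real.sqrt d)⁻¹ : ℝ) : ℂ) *
        (((b * b' * M * d : ℝ) : ℂ) ^ s) * ((b' : ℂ) ^ (-s)) =
      ((d * M : ℝ) : ℂ) ^ (s / 2) * (((d * M) ^ (((m : ℝ) - 1) / 2) * Real.sqrt d * b ^ m : ℝ) : ℂ) := by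
  have hsd : Real.sqrt d = Real.exp (Real.log d / 2) := by
    rw [Real.sqrt_eq_rpow, Real.rpow_def_of_pos hd]; ring_nf
  have h1 : (((M * b * Real.sqrt d)⁻¹ : ℝ) : ℂ) = Complex.exp (-((Real.log M : ℂ) + Real.log b + Real.log d / 2)) := by
    rw [hsd, show M * b * Real.exp (Real.log d / 2) = Real.exp (Real.log M + Real.log b + Real.log d / 2) by
      rw [Real.exp_add, Real.exp_add, Real.exp_log hM, Real.exp_log hb], ← Real.exp_neg]
    push_cast; ring_nf
  have h2 : (((d * M) ^ (((m : ℝ) - 1) / 2) * Real.sqrt d * b ^ m : ℝ) : ℂ) =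
      Complex.exp ((((m : ℂ) - 1) / 2) * (Real.log (d * M) : ℂ) + Real.log d / 2 + (m : ℂ) * Real.log b) := by
    rw [hsd, Real.rpow_def_of_pos (mul_pos hd hM), show b ^ m = Real.exp ((m : ℝ) * Real.log b) by
      rw [← Real.rpow_natCast, Real.rpow_def_of_pos hb, mul_comm], ← Real.exp_add, ← Real.exp_add]
    push_cast; ring_nf
  rw [ofReal_cpow_eq_exp (mul_pos hd hM), ofReal_cpow_eq_exp hb, h1, ofReal_cpow_eq_exp (by positivity),
    ofReal_cpow_eq_exp hb', ofReal_cpow_eq_exp (mul_pos hd hM), h2]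
  simp only [← Complex.exp_add]
  congr 1
  rw [Real.log_mul hd.ne' hM.ne', Real.log_mul (by positivity) hd.ne', Real.log_mul (by positivity) hM.ne',
    Real.log_mul hb.ne' hb'.ne']
  push_cast
  ring

/-! ## The `L`-series of `χ̄` by classes -/

section StarClasses

variable {𝔪 : Ideal (𝓞 K)} {ψ : HeightOneSpectrum (𝓞 K) → ℂ}

/-- The series of `χ̄ = star ψ` converges absolutely exactly when that of `χ` does (`|χ̄'(𝔞)| = |χ'(𝔞)|`).
[cite: NeukirchANT1999, Ch. VII §8 (8.1) Proposition] -/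
theorem summable_norm_rayClassCoeff_star_mul {s : ℂ}
    (hsum : Summable fun I : Ideal (𝓞 K) ↦ ‖rayClassCoeff 𝔪 ψ I * ((Ideal.absNorm I : ℕ) : ℂ) ^ (-s)‖) :
    Summable fun I : Ideal (𝓞 K) ↦ ‖rayClassCoeff 𝔪 (star ψ) I * ((Ideal.absNorm I : ℕ) : ℂ) ^ (-s)‖ := by
  refine hsum.congr fun I ↦ ?_
  rw [norm_mul, norm_mul, rayClassCoeff_star, RCLike.norm_conj]

/-- **`L(χ, s) = Σ_D Σ_{𝔞 ∈ [𝔟_D]⁻¹} χ'(𝔞) 𝔑𝔞^{-s}`** from absolute convergence alone, for any family of nonzero integral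
ideals `𝔟_D` whose classes run bijectively over the class group. [cite: NeukirchANT1999, Ch. VII §8, before (8.2)] -/
theorem rayClassLSeries_eq_sum_classes_of_summable (𝔟 : ClassGroup (𝓞 K) → Ideal (𝓞 K)) (h𝔟 : ∀ D, 𝔟 D ≠ ⊥)
    (hbij : Function.Bijective fun D ↦ ClassGroup.mk0 ⟨𝔟 D, mem_nonZeroDivisors_iff_ne_zero.mpr (h𝔟 D)⟩) {s : ℂ}
    (hsum' : Summable fun I : Ideal (𝓞 K) ↦ ‖rayClassCoeff 𝔪 ψ I * ((Ideal.absNorm I : ℕ) : ℂ) ^ (-s)‖) :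
    rayClassLSeries 𝔪 ψ s = ∑ D, ∑' 𝔞 : classImage ((𝔟 D : Ideal (𝓞 K)) : FractionalIdeal (𝓞 K)⁰ K),
      rayClassCoeff 𝔪 ψ 𝔞 * ((Ideal.absNorm (𝔞 : Ideal (𝓞 K)) : ℕ) : ℂ) ^ (-s) := by
  set f : Ideal (𝓞 K) → ℂ := fun I ↦ rayClassCoeff 𝔪 ψ I * ((Ideal.absNorm I : ℕ) : ℂ) ^ (-s) with hf
  have hsum : Summable f := hsum'.of_norm
  have hsupp : Function.support f ⊆ {I : Ideal (𝓞 K) | I ≠ ⊥} := by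
    intro I hI
    simp only [Function.mem_support, hf] at hI
    intro h0
    apply hI
    rw [h0, rayClassCoeff_bot, zero_mul]
  rw [rayClassLSeries, show (∑' I : Ideal (𝓞 K), rayClassCoeff 𝔪 ψ I * ((Ideal.absNorm I : ℕ) : ℂ) ^ (-s)) = ∑' I, f I from rfl,
    ← tsum_subtype_eq_of_support_subset hsupp]
  exact tsum_ne_bot_eq_sum_tsum_classImage 𝔟 h𝔟 hbij f (hsum.comp_injective Subtype.val_injective)

end StarClasses

/-! ## Hecke's functional equation -/

section Main

variable (w : {w : InfinitePlace K // IsComplex w}) (h2 : Module.finrank ℚ K = 2)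
  {𝔪 : Ideal (𝓞 K)} {ψ : HeightOneSpectrum (𝓞 K) → ℂ} {m : ℕ}

/-- `|d_K| · 𝔑𝔪` as a natural number cast to `ℂ` equals the real product cast. [cite: NeukirchANT1999, Ch. VII §8 (8.5)] -/
theorem natAbs_discr_mul_absNorm_cast (𝔪 : Ideal (𝓞 K)) :
    ((((discr K).natAbs * Ideal.absNorm 𝔪 : ℕ)) : ℂ) = ((|(discr K : ℝ)| * (Ideal.absNorm 𝔪 : ℝ) : ℝ) : ℂ) := by
  have h : (((discr K).natAbs : ℕ) : ℝ) = |(discr K : ℝ)| := by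
    rw [Nat.cast_natAbs, Int.cast_abs]
  push_cast
  rw [← h]
  norm_cast
set_option maxHeartbeats 400000 in
include h2 in
/-- **Hecke's functional equation for the `L`-series of a primitive Größencharakter of infinity type `(m, 0)`, `m ≥ 1`, of an
imaginary quadratic field** (de Shalit II.1.1 (1)–(3); Neukirch VII (8.6) Corollary with (8.5) Theorem; Hecke 1920).  For `ψ`
with `HasEmbPowType 𝔪 σ_w m ψ` (type `σ_w^m` on the ray mod `𝔪 ≠ 0`) and primitive finite part (`IsPrimitiveGross`): there
are `W` with `|W| = 1` and an ENTIRE `Λ` with `Λ(s) = (|d_K| 𝔑𝔪)^{s/2} (2π)^{-s} Γ(s) L(χ, s)` for `re s > m/2 + 1`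
(`L(χ,s) = rayClassLSeries 𝔪 ψ s`) and `Λ(m + 1 - s) = W · (|d_K| 𝔑𝔪)^{s/2} (2π)^{-s} Γ(s) L(χ̄, s)` there (`χ̄ = star ψ`).
Proof: Neukirch's, in the coset language of VII §8 Remark 1 with the harmonic weight — decomposition over ideal classes and
residues `mod 𝔪` into the strong FE-pairs `heckeThetaPairC` of coset theta functions (f-side `sum_grossFinitePart_mul_Λ_eq`),
Mathlib's Mellin principle for each pair, the dual side recombined through the Gauss sums (`sum_grossFinitePart_mul_symm_Λ_eq`),
the class independence of the normalised Gauss sum (`grossGaussSum_invariant`), `|τ| = √𝔑(𝔪)` and `|χ̃(𝔞)|² = 𝔑𝔞^m`.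
[cite: deShalit1987, II.1.1 (1)–(3)] [cite: NeukirchANT1999, Ch. VII §8 Cor. (8.6) and Thm. (8.5)] [cite: HeckeMathZ1920, §1] -/
theorem grossLSeries_functional_equation (hψ : HasEmbPowType 𝔪 w.1.embedding m ψ)
    (hprim : IsPrimitiveGross 𝔪 ψ w.1.embedding m) (hm : 1 ≤ m) (h𝔪 : 𝔪 ≠ ⊥) :
    ∃ (W : ℂ) (Λ : ℂ → ℂ), ‖W‖ = 1 ∧ Differentiable ℂ Λ ∧
      (∀ s : ℂ, (m : ℝ) / 2 + 1 < s.re → Λ s =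
        (((discr K).natAbs * Ideal.absNorm 𝔪 : ℕ) : ℂ) ^ (s / 2) * (2 * Real.pi : ℂ) ^ (-s) * Complex.Gamma s *
          rayClassLSeries 𝔪 ψ s) ∧
      (∀ s : ℂ, (m : ℝ) / 2 + 1 < s.re → Λ ((m : ℂ) + 1 - s) =
        W * ((((discr K).natAbs * Ideal.absNorm 𝔪 : ℕ) : ℂ) ^ (s / 2) * (2 * Real.pi : ℂ) ^ (-s) * Complex.Gamma s *
          rayClassLSeries 𝔪 (star ψ) s)) := by
  classical
  haveI : Finite (𝓞 K ⧸ 𝔪) := Ideal.finiteQuotientOfFreeOfNeBot 𝔪 h𝔪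
  haveI : Fintype (𝓞 K ⧸ 𝔪) := Fintype.ofFinite _
  set σ := w.1.embedding with hσdef
  set 𝔡 : Ideal (𝓞 K) := differentIdeal ℤ (𝓞 K) with h𝔡
  have h𝔡0 : 𝔡 ≠ ⊥ := fun h ↦ coeIdeal_differentIdeal_ne_zero (K := K) (by rw [← h𝔡, h, FractionalIdeal.coeIdeal_bot])
  have hN0 : (1 : ℕ) ≠ 0 := one_ne_zero
  -- class data
  choose 𝔟 h𝔟0 h𝔟cop h𝔟cl using fun C : ClassGroup (𝓞 K) ↦ exists_isCoprime_mk0_eq h𝔪 C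
  choose b₀ hb₀ hb₀0 hb₀1 using fun C : ClassGroup (𝓞 K) ↦ exists_mem_ne_zero_sub_one_mem (h𝔟0 C) (h𝔟cop C)
  have hm𝔡𝔟 : ∀ C, 𝔟 C * 𝔪 * 𝔡 ≠ ⊥ := fun C ↦ mul_ne_zero (mul_ne_zero (h𝔟0 C) h𝔪) h𝔡0
  choose 𝔟' h𝔟'0 h𝔟'cop h𝔟'cl using fun C : ClassGroup (𝓞 K) ↦ exists_isCoprime_mk0_eq h𝔪
    (ClassGroup.mk0 ⟨𝔟 C * 𝔪 * 𝔡, mem_nonZeroDivisors_iff_ne_zero.mpr (hm𝔡𝔟 C)⟩)⁻¹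
  have hβex : ∀ C, ∃ β : 𝓞 K, β ≠ 0 ∧ 𝔟 C * 𝔟' C * 𝔪 * 𝔡 = Ideal.span {β} := by
    intro C
    obtain ⟨x, hx0, hx⟩ := ClassGroup.mk0_eq_mk0_inv_iff.mp (h𝔟'cl C)
    refine ⟨x, hx0, ?_⟩
    rw [← hx]; change _ = 𝔟' C * (𝔟 C * 𝔪 * 𝔡); ring
  choose β hβ0 hβ using hβex
  choose x₁ hx₁ hx₁0 hx₁1 using fun C : ClassGroup (𝓞 K) ↦ exists_mem_ne_zero_sub_one_mem (h𝔟'0 C) (h𝔟'cop C)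
  -- the FE-pairs and the functions
  set r : 𝓞 K ⧸ 𝔪 → 𝓞 K := liftNZ K 𝔪 with hr
  set P : ClassGroup (𝓞 K) → 𝓞 K ⧸ 𝔪 → WeakFEPair ℂ := fun C q ↦
    NumberField.heckeThetaPairC K w h2 hm (Units.mk0 _ (coeIdeal_mul_ne_zero h𝔪 (h𝔟0 C))) ((r q : K) * b₀ C) with hP
  set F : ClassGroup (𝓞 K) → ℂ → ℂ := fun C s ↦ ∑ q, grossFinitePart K 𝔪 ψ σ m (r q) * (P C q).Λ s with hF
  set d : ℝ := |(discr K : ℝ)| with hd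
  set M : ℝ := (Ideal.absNorm 𝔪 : ℝ) with hM
  have hdpos : 0 < d := abs_pos.mpr (by exact_mod_cast discr_ne_zero K)
  have hMpos : 0 < M := by rw [hM]; exact_mod_cast Nat.pos_of_ne_zero (by rwa [ne_eq, Ideal.absNorm_eq_zero_iff])
  set A : ℂ → ℂ := fun s ↦ (((d * M : ℝ)) : ℂ) ^ (s / 2) with hA
  have hAnat : ∀ s : ℂ, (((discr K).natAbs * Ideal.absNorm 𝔪 : ℕ) : ℂ) ^ (s / 2) = A s := by
    intro s; rw [hA, natAbs_discr_mul_absNorm_cast]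
  set h₀ : ℂ := (orbitMult K 1 : ℂ) with hh₀
  have hh₀0 : h₀ ≠ 0 := by rw [hh₀]; exact_mod_cast orbitMult_ne_zero hN0
  have hI0 : ∀ C, idealPow K ψ (𝔟 C) ≠ 0 := fun C ↦ hψ.idealPow_ne_zero (h𝔟0 C) (h𝔟cop C)
  set Λ : ℂ → ℂ := fun s ↦ A s * h₀⁻¹ * ∑ C, (idealPow K ψ (𝔟 C))⁻¹ * ((Ideal.absNorm (𝔟 C) : ℕ) : ℂ) ^ s * F C s
    with hΛ
  -- the root number
  set y : ClassGroup (𝓞 K) → K := fun C ↦ (b₀ C : K) * x₁ C / β C with hy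
  set 𝔶 : ClassGroup (𝓞 K) → Ideal (𝓞 K) := fun C ↦
    eltIdeal (𝔟 C : FractionalIdeal (𝓞 K)⁰ K) (b₀ C) (FractionalIdeal.mem_coeIdeal_of_mem _ (hb₀ C)) *
      eltIdeal (𝔟' C : FractionalIdeal (𝓞 K)⁰ K) (x₁ C) (FractionalIdeal.mem_coeIdeal_of_mem _ (hx₁ C)) with h𝔶
  have hdataC : ∀ C, ((𝔶 C : FractionalIdeal (𝓞 K)⁰ K) =
      FractionalIdeal.spanSingleton (𝓞 K)⁰ (y C) * 𝔪 * differentIdeal ℤ (𝓞 K)) ∧ IsCoprime (𝔶 C) 𝔪 ∧ y C ≠ 0 ∧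
      idealPow K ψ (𝔶 C) * idealPow K ψ (𝔟 C) * idealPow K ψ (𝔟' C) = σ (b₀ C : K) ^ m * σ (x₁ C : K) ^ m := fun C ↦
    grossClassData_aux hψ h𝔪 (h𝔟0 C) (hb₀ C) (hb₀0 C) (hb₀1 C) (h𝔟'0 C) (hx₁ C) (hx₁0 C) (hx₁1 C) (hβ0 C) (hβ C)
  -- the normalised Gauss sum `T` (class independent) and the per-class constants `WC`
  set T : ClassGroup (𝓞 K) → ℂ := fun C ↦ idealPow K ψ (𝔶 C) * grossGaussSum K 𝔪 ψ σ m (y C) * (σ (y C) ^ m)⁻¹ with hT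
  have hσy : ∀ C, σ (y C) ^ m ≠ 0 := fun C ↦ pow_ne_zero _ ((map_ne_zero σ).mpr (hdataC C).2.2.1)
  have hTC : ∀ C, T C = T 1 := by
    intro C
    have hinv := grossGaussSum_invariant hψ h𝔪 (hdataC 1).2.2.1 (hdataC C).2.2.1 (hdataC 1).1 (hdataC C).1
      (hdataC 1).2.1 (hdataC C).2.1
    -- `χ̃(𝔶_C) σ(y₁)^m τ(y_C) = χ̃(𝔶₁) σ(y_C)^m τ(y₁)`
    have h1 : σ (y C) ≠ 0 := (map_ne_zero σ).mpr (hdataC C).2.2.1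
    have h1' : σ (y 1) ≠ 0 := (map_ne_zero σ).mpr (hdataC 1).2.2.1
    simp only [hT]
    rw [← div_eq_mul_inv, ← div_eq_mul_inv, div_eq_div_iff (hσy C) (hσy 1)]
    linear_combination hinv
  set κ : ℝ := (d * M) ^ (((m : ℝ) - 1) / 2) * Real.sqrt d with hκ
  have hκpos : 0 < κ := by rw [hκ]; positivity
  set WC : ClassGroup (𝓞 K) → ℂ := fun C ↦ (-Complex.I) ^ m * (κ : ℂ) * ((Ideal.absNorm (𝔟 C) : ℕ) : ℂ) ^ m *
    grossGaussSum K 𝔪 ψ σ m (y C) * starRingEnd ℂ (idealPow K ψ (𝔟' C)) * (idealPow K ψ (𝔟 C))⁻¹ *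
      (starRingEnd ℂ (σ (β C : K)) ^ m)⁻¹ with hWC
  -- norm bookkeeping: `|N β| = N𝔟 N𝔟' M d`, `conj χ̃(𝔟') χ̃(𝔟') = N𝔟'^m`, `conj σβ · σβ = |Nβ|`
  have hnormβ : ∀ C, (|(Algebra.norm ℚ (β C : K) : ℚ)| : ℝ) =
      (Ideal.absNorm (𝔟 C) : ℝ) * (Ideal.absNorm (𝔟' C) : ℝ) * M * d := fun C ↦ by
    rw [abs_norm_eq_of_span_eq (hβ C), hM, hd]
  have hβK : ∀ C, ((β C : 𝓞 K) : K) ≠ 0 := fun C ↦ by exact_mod_cast hβ0 C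
  have hσβ : ∀ C, starRingEnd ℂ (σ (β C : K)) ^ m ≠ 0 := fun C ↦
    pow_ne_zero _ (by rw [map_ne_zero]; exact (map_ne_zero σ).mpr (hβK C))
  have hconjβ : ∀ C, starRingEnd ℂ (σ (β C : K)) ^ m * σ (β C : K) ^ m =
      ((((Ideal.absNorm (𝔟 C) : ℝ) * (Ideal.absNorm (𝔟' C) : ℝ) * M * d) ^ m : ℝ) : ℂ) := by
    intro C
    rw [← mul_pow, ← Complex.normSq_eq_conj_mul_self, Complex.normSq_eq_norm_sq,
      NumberField.norm_embedding_sq_eq_abs_norm w h2, hnormβ C]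
    push_cast; ring
  have hconj𝔟' : ∀ C, starRingEnd ℂ (idealPow K ψ (𝔟' C)) * idealPow K ψ (𝔟' C) =
      ((((Ideal.absNorm (𝔟' C) : ℕ) : ℝ) ^ m : ℝ) : ℂ) := by
    intro C
    rw [← Complex.normSq_eq_conj_mul_self, Complex.normSq_eq_norm_sq, sq_norm_idealPow_eq_absNorm_pow w h2 hψ h𝔪 (h𝔟'0 C)
      (h𝔟'cop C)]
  -- `WC C = (-i)^m κ (Md)^{-m} T C`
  have hWT : ∀ C, WC C = (-Complex.I) ^ m * (κ : ℂ) * ((((M * d) ^ m : ℝ) : ℂ))⁻¹ * T C := by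
    intro C
    have hMd : ((((M * d) ^ m : ℝ) : ℂ)) ≠ 0 := by exact_mod_cast (pow_pos (mul_pos hMpos hdpos) m).ne'
    have hP0 : σ (b₀ C : K) ^ m * σ (x₁ C : K) ^ m ≠ 0 := mul_ne_zero
      (pow_ne_zero _ ((map_ne_zero σ).mpr (by exact_mod_cast hb₀0 C)))
      (pow_ne_zero _ ((map_ne_zero σ).mpr (by exact_mod_cast hx₁0 C)))
    have hI0' : idealPow K ψ (𝔟' C) ≠ 0 := hψ.idealPow_ne_zero (h𝔟'0 C) (h𝔟'cop C)
    have hF1 := (hdataC C).2.2.2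
    have hF2 : σ (y C) ^ m * σ (β C : K) ^ m = σ (b₀ C : K) ^ m * σ (x₁ C : K) ^ m := by
      rw [← mul_pow, ← mul_pow, ← map_mul, ← map_mul, hy]
      simp only
      rw [div_mul_cancel₀ _ (hβK C)]
    have hF3 := hconj𝔟' C
    have hF4 := hconjβ C
    have hb𝔟' : ((((Ideal.absNorm (𝔟' C) : ℕ) : ℝ) ^ m : ℝ) : ℂ) = ((Ideal.absNorm (𝔟' C) : ℕ) : ℂ) ^ m := by push_cast; ring
    have hMd' : ((((Ideal.absNorm (𝔟 C) : ℝ) * (Ideal.absNorm (𝔟' C) : ℝ) * M * d) ^ m : ℝ) : ℂ) =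
        ((Ideal.absNorm (𝔟 C) : ℕ) : ℂ) ^ m * ((Ideal.absNorm (𝔟' C) : ℕ) : ℂ) ^ m * (((M * d) ^ m : ℝ) : ℂ) := by
      push_cast; ring
    rw [hb𝔟'] at hF3
    rw [hMd'] at hF4
    have hI𝔶 : idealPow K ψ (𝔶 C) ≠ 0 := by
      have h𝔶0 : 𝔶 C ≠ ⊥ := by
        intro h0
        have := (hdataC C).1
        rw [h0, FractionalIdeal.coeIdeal_bot, eq_comm, mul_eq_zero, mul_eq_zero, FractionalIdeal.spanSingleton_eq_zero_iff] at this
        rcases this with (h' | h') | h'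
        · exact (hdataC C).2.2.1 h'
        · exact coeIdeal_ne_zero' (K := K) h𝔪 h'
        · exact coeIdeal_differentIdeal_ne_zero (K := K) h'
      exact hψ.idealPow_ne_zero h𝔶0 (hdataC C).2.1
    have hN0' : ((Ideal.absNorm (𝔟 C) : ℕ) : ℂ) ^ m ≠ 0 := pow_ne_zero _ (by
      exact_mod_cast (by rw [ne_eq, Ideal.absNorm_eq_zero_iff]; exact h𝔟0 C : Ideal.absNorm (𝔟 C) ≠ 0))
    have hN0'' : ((Ideal.absNorm (𝔟' C) : ℕ) : ℂ) ^ m ≠ 0 := pow_ne_zero _ (by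
      exact_mod_cast (by rw [ne_eq, Ideal.absNorm_eq_zero_iff]; exact h𝔟'0 C : Ideal.absNorm (𝔟' C) ≠ 0))
    have hσβ' : σ (β C : K) ^ m ≠ 0 := pow_ne_zero _ ((map_ne_zero σ).mpr (hβK C))
    -- the four inverses, rewritten through the four facts
    have e1 : (idealPow K ψ (𝔟 C))⁻¹ = idealPow K ψ (𝔶 C) * idealPow K ψ (𝔟' C) *
        (idealPow K ψ (𝔶 C) * idealPow K ψ (𝔟 C) * idealPow K ψ (𝔟' C))⁻¹ := by
      field_simp
    have e2 : (σ (y C) ^ m)⁻¹ = σ (β C : K) ^ m * (σ (y C) ^ m * σ (β C : K) ^ m)⁻¹ := by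
      field_simp
    have e3 : (starRingEnd ℂ (σ (β C : K)) ^ m)⁻¹ =
        σ (β C : K) ^ m * (starRingEnd ℂ (σ (β C : K)) ^ m * σ (β C : K) ^ m)⁻¹ := by
      field_simp
    have e4 : starRingEnd ℂ (idealPow K ψ (𝔟' C)) =
        (starRingEnd ℂ (idealPow K ψ (𝔟' C)) * idealPow K ψ (𝔟' C)) * (idealPow K ψ (𝔟' C))⁻¹ := by
      field_simp
    rw [hF1] at e1
    rw [hF2] at e2
    rw [hF4] at e3
    rw [hF3] at e4
    simp only [hWC, hT]
    rw [e1, e2, e3, e4]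
    field_simp
  have hWCeq : ∀ C, WC C = WC 1 := fun C ↦ by rw [hWT C, hWT 1, hTC C]
  set W : ℂ := WC 1 with hW
  -- `|W| = 1`
  have hWnorm : ‖W‖ = 1 := by
    have hNpos : 0 < (Ideal.absNorm (𝔟 1) : ℝ) := by
      exact_mod_cast Nat.pos_of_ne_zero (by rw [ne_eq, Ideal.absNorm_eq_zero_iff]; exact h𝔟0 1)
    have hN'pos : 0 < (Ideal.absNorm (𝔟' 1) : ℝ) := by
      exact_mod_cast Nat.pos_of_ne_zero (by rw [ne_eq, Ideal.absNorm_eq_zero_iff]; exact h𝔟'0 1)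
    have hτ : ‖grossGaussSum K 𝔪 ψ σ m (y 1)‖ = Real.sqrt M :=
      norm_grossGaussSum hψ hprim h𝔪 (hdataC 1).1 (hdataC 1).2.1
    have ha : ‖idealPow K ψ (𝔟 1)‖ ^ 2 = (Ideal.absNorm (𝔟 1) : ℝ) ^ m :=
      sq_norm_idealPow_eq_absNorm_pow w h2 hψ h𝔪 (h𝔟0 1) (h𝔟cop 1)
    have ha' : ‖idealPow K ψ (𝔟' 1)‖ ^ 2 = (Ideal.absNorm (𝔟' 1) : ℝ) ^ m :=
      sq_norm_idealPow_eq_absNorm_pow w h2 hψ h𝔪 (h𝔟'0 1) (h𝔟'cop 1)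
    have hc : ‖σ (β 1 : K)‖ ^ 2 = (Ideal.absNorm (𝔟 1) : ℝ) * (Ideal.absNorm (𝔟' 1) : ℝ) * M * d := by
      rw [NumberField.norm_embedding_sq_eq_abs_norm w h2, hnormβ 1]
    have hκ2 : κ ^ 2 = (d * M) ^ (m - 1) * d := by
      rw [hκ, mul_pow, Real.sq_sqrt hdpos.le, ← Real.rpow_natCast ((d * M) ^ (((m : ℝ) - 1) / 2)) 2,
        ← Real.rpow_mul (mul_pos hdpos hMpos).le]
      have hm1 : ((m : ℝ) - 1) / 2 * ((2 : ℕ) : ℝ) = ((m - 1 : ℕ) : ℝ) := by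
        rw [Nat.cast_sub hm]; push_cast; ring
      rw [hm1, Real.rpow_natCast]
    have hdm : (d * M) ^ (m - 1) * (d * M) = (d * M) ^ m := by
      rw [← pow_succ, Nat.sub_add_cancel hm]
    have hane : ‖idealPow K ψ (𝔟 1)‖ ≠ 0 := norm_ne_zero_iff.mpr (hI0 1)
    have hcne : ‖σ (β 1 : K)‖ ^ m ≠ 0 := pow_ne_zero _ (norm_ne_zero_iff.mpr ((map_ne_zero σ).mpr (hβK 1)))
    -- the key real identity `κ N^m √M ‖χ̃𝔟'‖ = ‖χ̃𝔟‖ ‖σβ‖^m` (compare squares)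
    have key : κ * (Ideal.absNorm (𝔟 1) : ℝ) ^ m * Real.sqrt M * ‖idealPow K ψ (𝔟' 1)‖ =
        ‖idealPow K ψ (𝔟 1)‖ * ‖σ (β 1 : K)‖ ^ m := by
      have hl : 0 ≤ κ * (Ideal.absNorm (𝔟 1) : ℝ) ^ m * Real.sqrt M * ‖idealPow K ψ (𝔟' 1)‖ := by positivity
      have hr' : 0 ≤ ‖idealPow K ψ (𝔟 1)‖ * ‖σ (β 1 : K)‖ ^ m := by positivity
      refine (pow_left_inj₀ hl hr' two_ne_zero).mp ?_
      calc (κ * (Ideal.absNorm (𝔟 1) : ℝ) ^ m * Real.sqrt M * ‖idealPow K ψ (𝔟' 1)‖) ^ 2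
          = κ ^ 2 * ((Ideal.absNorm (𝔟 1) : ℝ) ^ m) ^ 2 * Real.sqrt M ^ 2 * ‖idealPow K ψ (𝔟' 1)‖ ^ 2 := by ring
        _ = (d * M) ^ (m - 1) * d * ((Ideal.absNorm (𝔟 1) : ℝ) ^ m) ^ 2 * M * (Ideal.absNorm (𝔟' 1) : ℝ) ^ m := by
            rw [hκ2, Real.sq_sqrt hMpos.le, ha']
        _ = (Ideal.absNorm (𝔟 1) : ℝ) ^ m * ((Ideal.absNorm (𝔟 1) : ℝ) * (Ideal.absNorm (𝔟' 1) : ℝ) * M * d) ^ m := by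
            linear_combination (((Ideal.absNorm (𝔟 1) : ℝ) ^ m) ^ 2 * (Ideal.absNorm (𝔟' 1) : ℝ) ^ m) * hdm
        _ = (‖idealPow K ψ (𝔟 1)‖ * ‖σ (β 1 : K)‖ ^ m) ^ 2 := by
            rw [mul_pow (‖idealPow K ψ (𝔟 1)‖) (‖σ (β 1 : K)‖ ^ m) 2, ← pow_mul (‖σ (β 1 : K)‖) m 2, mul_comm m 2,
              pow_mul (‖σ (β 1 : K)‖) 2 m, ha, hc]
    rw [hW, hWC]
    simp only [norm_mul, norm_pow, norm_neg, Complex.norm_I, one_pow, one_mul, Complex.norm_real, norm_inv,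
      RCLike.norm_conj, Complex.norm_natCast, Real.norm_eq_abs, abs_of_pos hκpos, hτ]
    field_simp
    linear_combination key
  refine ⟨W, Λ, hWnorm, ?_, ?_, ?_⟩
  · -- `Λ` is entire
    have hAd : Differentiable ℂ A := by
      intro s
      rw [hA]
      exact DifferentiableAt.const_cpow (by fun_prop) (Or.inl (Complex.ofReal_ne_zero.mpr (mul_pos hdpos hMpos).ne'))
    have hNd : ∀ C, Differentiable ℂ (fun s : ℂ ↦ ((Ideal.absNorm (𝔟 C) : ℕ) : ℂ) ^ s) := fun C s ↦
      DifferentiableAt.const_cpow (by fun_prop) (Or.inl (by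
        exact_mod_cast (by rw [ne_eq, Ideal.absNorm_eq_zero_iff]; exact h𝔟0 C : Ideal.absNorm (𝔟 C) ≠ 0)))
    have hFd : ∀ C, Differentiable ℂ (F C) := fun C ↦ by
      have h := Differentiable.sum (u := (Finset.univ : Finset (𝓞 K ⧸ 𝔪)))
        (A := fun q ↦ fun s : ℂ ↦ grossFinitePart K 𝔪 ψ σ m (r q) * (P C q).Λ s)
        fun q _ ↦ (NumberField.differentiable_heckeThetaPairC_Λ w h2 hm _ _).const_mul _
      rw [Finset.sum_fn] at h
      simp only [hF]
      exact h
    have hSd : Differentiable ℂ (fun s : ℂ ↦ ∑ C, (idealPow K ψ (𝔟 C))⁻¹ * ((Ideal.absNorm (𝔟 C) : ℕ) : ℂ) ^ s * F C s) := by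
      have h := Differentiable.sum (u := (Finset.univ : Finset (ClassGroup (𝓞 K))))
        (A := fun C ↦ fun s : ℂ ↦ (idealPow K ψ (𝔟 C))⁻¹ * ((Ideal.absNorm (𝔟 C) : ℕ) : ℂ) ^ s * F C s)
        fun C _ ↦ (((hNd C).const_mul _).mul (hFd C))
      rw [Finset.sum_fn] at h
      exact h
    exact ((hAd.mul (differentiable_const _)).mul hSd)
  · -- the value on `re s > m/2 + 1`
    intro s hs
    have hbij : Function.Bijective fun D ↦ ClassGroup.mk0 ⟨𝔟 D, mem_nonZeroDivisors_iff_ne_zero.mpr (h𝔟0 D)⟩ := by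
      have : (fun D ↦ ClassGroup.mk0 ⟨𝔟 D, mem_nonZeroDivisors_iff_ne_zero.mpr (h𝔟0 D)⟩) = id := funext fun D ↦ h𝔟cl D
      rw [this]; exact Function.bijective_id
    have hL := rayClassLSeries_eq_sum_classes_of_embPowType w h2 hψ h𝔪 hm 𝔟 h𝔟0 hbij hs
    have hFC : ∀ C, (idealPow K ψ (𝔟 C))⁻¹ * ((Ideal.absNorm (𝔟 C) : ℕ) : ℂ) ^ s * F C s =
        (2 * Real.pi : ℂ) ^ (-s) * Complex.Gamma s * h₀ *
          ∑' 𝔞 : classImage ((𝔟 C : Ideal (𝓞 K)) : FractionalIdeal (𝓞 K)⁰ K),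
            rayClassCoeff 𝔪 ψ 𝔞 * ((Ideal.absNorm (𝔞 : Ideal (𝓞 K)) : ℕ) : ℂ) ^ (-s) := by
      intro C
      have hf := sum_grossFinitePart_mul_Λ_eq w h2 hψ hm h𝔪 (h𝔟0 C) (h𝔟cop C) (hb₀ C) (hb₀1 C) hN0 hs
      simp only [hF]
      rw [hf]
      have hs0 : s ≠ 0 := by
        intro h0; rw [h0, Complex.zero_re] at hs
        have hm0 : (0 : ℝ) ≤ (m : ℝ) / 2 := by positivity
        linarith
      have hNN : ((Ideal.absNorm (𝔟 C) : ℕ) : ℂ) ^ s * ((Ideal.absNorm (𝔟 C) : ℕ) : ℂ) ^ (-s) = 1 := by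
        rw [Complex.cpow_neg, mul_inv_cancel₀]
        exact (Complex.cpow_ne_zero_iff_of_exponent_ne_zero hs0).mpr (by
            exact_mod_cast (by rw [ne_eq, Ideal.absNorm_eq_zero_iff]; exact h𝔟0 C : Ideal.absNorm (𝔟 C) ≠ 0))
      have h1 : (idealPow K ψ (𝔟 C))⁻¹ * idealPow K ψ (𝔟 C) = 1 := inv_mul_cancel₀ (hI0 C)
      linear_combination ((2 * Real.pi : ℂ) ^ (-s) * Complex.Gamma s * h₀ *
          ∑' 𝔞 : classImage ((𝔟 C : Ideal (𝓞 K)) : FractionalIdeal (𝓞 K)⁰ K),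
            rayClassCoeff 𝔪 ψ 𝔞 * ((Ideal.absNorm (𝔞 : Ideal (𝓞 K)) : ℕ) : ℂ) ^ (-s)) *
          ((((Ideal.absNorm (𝔟 C) : ℕ) : ℂ) ^ s * ((Ideal.absNorm (𝔟 C) : ℕ) : ℂ) ^ (-s)) * h1 + hNN)
    simp only [hΛ]
    rw [Finset.sum_congr rfl (fun C _ ↦ hFC C), ← Finset.mul_sum, ← hL, hAnat]
    field_simp
  · -- the functional equation on `re s > m/2 + 1`
    intro s hs
    set g : ClassGroup (𝓞 K) := ClassGroup.mk0 ⟨𝔪 * 𝔡, mem_nonZeroDivisors_iff_ne_zero.mpr (mul_ne_zero h𝔪 h𝔡0)⟩ with hg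
    have hcl' : ∀ D, ClassGroup.mk0 ⟨𝔟' D, mem_nonZeroDivisors_iff_ne_zero.mpr (h𝔟'0 D)⟩ = D⁻¹ * g⁻¹ := by
      intro D
      have hDg : ClassGroup.mk0 ⟨𝔟 D * 𝔪 * 𝔡, mem_nonZeroDivisors_iff_ne_zero.mpr (hm𝔡𝔟 D)⟩ = D * g := by
        conv_rhs => rw [← h𝔟cl D]
        rw [hg, ← map_mul]
        congr 1
        exact Subtype.ext (mul_assoc _ _ _)
      rw [h𝔟'cl D, hDg, mul_inv_rev, mul_comm]
    have hbij' : Function.Bijective fun D ↦ ClassGroup.mk0 ⟨𝔟' D, mem_nonZeroDivisors_iff_ne_zero.mpr (h𝔟'0 D)⟩ := by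
      have : (fun D ↦ ClassGroup.mk0 ⟨𝔟' D, mem_nonZeroDivisors_iff_ne_zero.mpr (h𝔟'0 D)⟩) = fun D ↦ D⁻¹ * g⁻¹ :=
        funext hcl'
      rw [this]
      refine ⟨fun D₁ D₂ h ↦ by simpa using h, fun E ↦ ⟨(E * g)⁻¹, by simp⟩⟩
    have hL' := rayClassLSeries_eq_sum_classes_of_summable 𝔟' h𝔟'0 hbij'
      (summable_norm_rayClassCoeff_star_mul (summable_norm_rayClassCoeff_mul_of_embPowType w h2 hψ h𝔪 hm hs))
    -- per class
    have hfe : ∀ C q, (P C q).Λ ((m : ℂ) + 1 - s) = (P C q).ε * (P C q).symm.Λ s := fun C q ↦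
      NumberField.heckeThetaPairC_Λ_sub w h2 hm _ _ s
    have hFC : ∀ C, F C ((m : ℂ) + 1 - s) = (P C 1).ε * ∑ q, grossFinitePart K 𝔪 ψ σ m (r q) * (P C q).symm.Λ s := by
      intro C
      simp only [hF, Finset.mul_sum]
      refine Finset.sum_congr rfl fun q _ ↦ ?_
      have hε : (P C q).ε = (P C 1).ε := rfl
      rw [hfe C q, hε]; ring
    have hyC : ∀ C, y C ∈ FractionalIdeal.dual ℤ ℚ (𝔪 : FractionalIdeal (𝓞 K)⁰ K) := fun C ↦
      mem_dual_of_coeIdeal_eq h𝔪 (hdataC C).1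
    have hGC : ∀ C, ∑ q, grossFinitePart K 𝔪 ψ σ m (r q) * (P C q).symm.Λ s =
        (2 * Real.pi : ℂ) ^ (-s) * Complex.Gamma s *
          grossGaussSum K 𝔪 ψ σ m (y C) * h₀ * (starRingEnd ℂ (σ (β C : K)) ^ m)⁻¹ *
          (((|(Algebra.norm ℚ (β C : K) : ℚ)| : ℝ)) : ℂ) ^ s *
          starRingEnd ℂ (idealPow K ψ (𝔟' C)) * ((Ideal.absNorm (𝔟' C) : ℕ) : ℂ) ^ (-s) *
          ∑' 𝔞 : classImage ((𝔟' C : Ideal (𝓞 K)) : FractionalIdeal (𝓞 K)⁰ K),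
            rayClassCoeff 𝔪 (star ψ) 𝔞 * ((Ideal.absNorm (𝔞 : Ideal (𝓞 K)) : ℕ) : ℂ) ^ (-s) := fun C ↦
      sum_grossFinitePart_mul_symm_Λ_eq w h2 hψ hprim hm h𝔪 (h𝔟0 C) (hb₀ C) (h𝔟'0 C) (h𝔟'cop C) (hx₁ C) (hx₁1 C)
        (hβ0 C) (hβ C) (hyC C) hN0 hs
    have hεC : ∀ C, (P C 1).ε = (-Complex.I) ^ m * ((((M * (Ideal.absNorm (𝔟 C) : ℝ) * Real.sqrt d)⁻¹ : ℝ)) : ℂ) := by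
      intro C
      simp only [hP]
      rw [NumberField.heckeThetaPairC_ε, Units.val_mk0, FractionalIdeal.coeIdeal_absNorm, map_mul, hM, hd]
      push_cast
      ring
    -- assemble
    have hkey : ∀ C, A ((m : ℂ) + 1 - s) *
        ((idealPow K ψ (𝔟 C))⁻¹ * ((Ideal.absNorm (𝔟 C) : ℕ) : ℂ) ^ ((m : ℂ) + 1 - s) * F C ((m : ℂ) + 1 - s)) =
        WC C * A s * ((2 * Real.pi : ℂ) ^ (-s) * Complex.Gamma s * h₀) *
          ∑' 𝔞 : classImage ((𝔟' C : Ideal (𝓞 K)) : FractionalIdeal (𝓞 K)⁰ K),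
            rayClassCoeff 𝔪 (star ψ) 𝔞 * ((Ideal.absNorm (𝔞 : Ideal (𝓞 K)) : ℕ) : ℂ) ^ (-s) := by
      intro C
      have hb : 0 < (Ideal.absNorm (𝔟 C) : ℝ) := by
        exact_mod_cast Nat.pos_of_ne_zero (by rw [ne_eq, Ideal.absNorm_eq_zero_iff]; exact h𝔟0 C)
      have hb' : 0 < (Ideal.absNorm (𝔟' C) : ℝ) := by
        exact_mod_cast Nat.pos_of_ne_zero (by rw [ne_eq, Ideal.absNorm_eq_zero_iff]; exact h𝔟'0 C)
      have hscal := grossRootNumber_scalar_identity hdpos hMpos hb hb' m s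
      rw [← hκ] at hscal
      rw [hFC C, hGC C, hεC C, hnormβ C, hWC]
      simp only [hA]
      push_cast
      push_cast at hscal
      linear_combination ((-Complex.I) ^ m * (2 * Real.pi : ℂ) ^ (-s) * Complex.Gamma s * h₀ *
        grossGaussSum K 𝔪 ψ σ m (y C) * starRingEnd ℂ (idealPow K ψ (𝔟' C)) * (idealPow K ψ (𝔟 C))⁻¹ *
        (starRingEnd ℂ (σ (β C : K)) ^ m)⁻¹ *
        ∑' 𝔞 : classImage ((𝔟' C : Ideal (𝓞 K)) : FractionalIdeal (𝓞 K)⁰ K),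
          rayClassCoeff 𝔪 (star ψ) 𝔞 * ((Ideal.absNorm (𝔞 : Ideal (𝓞 K)) : ℕ) : ℂ) ^ (-s)) * hscal
    have hLHS : Λ ((m : ℂ) + 1 - s) = ∑ C, A ((m : ℂ) + 1 - s) * h₀⁻¹ *
        ((idealPow K ψ (𝔟 C))⁻¹ * ((Ideal.absNorm (𝔟 C) : ℕ) : ℂ) ^ ((m : ℂ) + 1 - s) * F C ((m : ℂ) + 1 - s)) := by
      simp only [hΛ]; rw [Finset.mul_sum]
    rw [hLHS, hAnat, hL', Finset.mul_sum, Finset.mul_sum]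
    refine Finset.sum_congr rfl fun C _ ↦ ?_
    have hk := hkey C
    rw [hWCeq C] at hk
    calc A ((m : ℂ) + 1 - s) * h₀⁻¹ *
          ((idealPow K ψ (𝔟 C))⁻¹ * ((Ideal.absNorm (𝔟 C) : ℕ) : ℂ) ^ ((m : ℂ) + 1 - s) * F C ((m : ℂ) + 1 - s))
        = h₀⁻¹ * (A ((m : ℂ) + 1 - s) *
          ((idealPow K ψ (𝔟 C))⁻¹ * ((Ideal.absNorm (𝔟 C) : ℕ) : ℂ) ^ ((m : ℂ) + 1 - s) * F C ((m : ℂ) + 1 - s))) := by ring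
      _ = h₀⁻¹ * (W * A s * ((2 * Real.pi : ℂ) ^ (-s) * Complex.Gamma s * h₀) *
          ∑' 𝔞 : classImage ((𝔟' C : Ideal (𝓞 K)) : FractionalIdeal (𝓞 K)⁰ K),
            rayClassCoeff 𝔪 (star ψ) 𝔞 * ((Ideal.absNorm (𝔞 : Ideal (𝓞 K)) : ℕ) : ℂ) ^ (-s)) := by rw [hk]
      _ = W * (A s * (2 * Real.pi : ℂ) ^ (-s) * Complex.Gamma s *
          ∑' 𝔞 : classImage ((𝔟' C : Ideal (𝓞 K)) : FractionalIdeal (𝓞 K)⁰ K),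
            rayClassCoeff 𝔪 (star ψ) 𝔞 * ((Ideal.absNorm (𝔞 : Ideal (𝓞 K)) : ℕ) : ℂ) ^ (-s)) := by
          field_simp

include h2 in
/-- **Hecke's functional equation, two-function form** (the shape of de Shalit II.1.1 (3) and of the tree's named fact
`Hecke_functionalEquation_infinityType_conductor`): ENTIRE `Λ`, `Λ'` with `Λ(s) = (|d_K| 𝔑𝔪)^{s/2} (2π)^{-s} Γ(s) L(χ, s)`,
`Λ'(s) = (|d_K| 𝔑𝔪)^{s/2} (2π)^{-s} Γ(s) L(χ̄, s)` on `re s > m/2 + 1`, and `Λ(s) = W Λ'(m + 1 - s)` for ALL `s`, `|W| = 1`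
(`Λ'(s) := W⁻¹ Λ(m + 1 - s)`). [cite: deShalit1987, II.1.1 (1)–(3)] [cite: NeukirchANT1999, Ch. VII §8 Cor. (8.6) and Thm. (8.5)] -/
theorem grossLSeries_functional_equation' (hψ : HasEmbPowType 𝔪 w.1.embedding m ψ)
    (hprim : IsPrimitiveGross 𝔪 ψ w.1.embedding m) (hm : 1 ≤ m) (h𝔪 : 𝔪 ≠ ⊥) :
    ∃ (W : ℂ) (Λ Λ' : ℂ → ℂ), ‖W‖ = 1 ∧ Differentiable ℂ Λ ∧ Differentiable ℂ Λ' ∧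
      (∀ s : ℂ, (m : ℝ) / 2 + 1 < s.re →
        Λ s = (((discr K).natAbs * Ideal.absNorm 𝔪 : ℕ) : ℂ) ^ (s / 2) * (2 * Real.pi : ℂ) ^ (-s) * Complex.Gamma s *
          rayClassLSeries 𝔪 ψ s ∧
        Λ' s = (((discr K).natAbs * Ideal.absNorm 𝔪 : ℕ) : ℂ) ^ (s / 2) * (2 * Real.pi : ℂ) ^ (-s) * Complex.Gamma s *
          rayClassLSeries 𝔪 (star ψ) s) ∧
      ∀ s : ℂ, Λ s = W * Λ' ((m : ℂ) + 1 - s) := by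
  obtain ⟨W, Λ, hW, hd, hval, hfe⟩ := grossLSeries_functional_equation w h2 hψ hprim hm h𝔪
  have hW0 : W ≠ 0 := fun h ↦ by rw [h, norm_zero] at hW; exact zero_ne_one hW
  refine ⟨W, Λ, fun s ↦ W⁻¹ * Λ ((m : ℂ) + 1 - s), hW, hd, ?_, fun s hs ↦ ⟨hval s hs, ?_⟩, fun s ↦ ?_⟩
  · exact (differentiable_const _).mul (hd.comp ((differentiable_const _).sub differentiable_id))
  · simp only []
    rw [hfe s hs, ← mul_assoc, inv_mul_cancel₀ hW0, one_mul]
  · simp only []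
    rw [show (m : ℂ) + 1 - ((m : ℂ) + 1 - s) = s by ring, ← mul_assoc, mul_inv_cancel₀ hW0, one_mul]

end Main

end Literature.NumberTheory.LFunctions

end
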